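/-
Copyright: the b2b-balaban cell (near-miss cell 7), T⁴-continuum fan-out, lineage t4-ne7b-p1 (node U5c COUNT member).
Released under the licence of the surrounding project.
-/
import Summits.QuantumFields.BalabanUV.T4Continuum.Support.PlacementBatch
import Literature.MathematicalPhysics.QuantumFieldTheory.Balaban1983to89.T4PrintedShapeBanking

/-!
# Placement skeleton (part 3b): the batch factorials are absorbed by the QUADRATIC BIRTH CREDIT — lower `a` by any `θ > 0`

Summits-side support leaf of the T⁴-continuum cell (rung (B)+1 on a FINITE torus only; NOT infinite volume, NOT the
mass gap, NOT the Clay statement; NOT a proof of the spine estimate NE7b).  Lineage `t4-ne7b-p1`, node U5c, wall (GM),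
located item G-ne7bp1g18-2, continuation of part 3 (`Support/PlacementBatch.lean`).  [folklore] real arithmetic over
the carrier's OWN typed credits (`T4BankedInduction.credits`, `T4PrintedShapeBanking.credit`); nothing is quoted from
print and nothing printed is asserted.

WHAT.  The multiplicity binder `hlabM` of `T4PartnerMultiplicity.exists_irThreshold_relWeightBoundM` compares a slot price
with `Λ′^{partnerAges G} · e^{−credits (credit C g) G} · e^{+lifeCost}`, where a birth `(s, 0, d′)` is credited
`credit C g (s,0,d′) = C.a · p₀(g_s)² · (d′ + 1) + 2 p₀(g_s)` (`T4PrintedShapeBanking.credit`).  Part 3 showed that the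
per-step batch factorials `∏_t n_t!` of a genealogy's births are paid by ANY class-linear rate `θ·Σ d′` at a constant
`1 + 2/θ` per birth.  Here the rate is taken out of the quadratic birth credit: with `lowerA C θ := {C with a := C.a − θ}`
and `p₀(g_s) ≥ 1` at the birth steps (a DISPLAYED binder — the regime `1 ≤ log (g_s²)⁻¹` of the consumer makes
`p₀(g_s) = A₀ (log g_s⁻²)^{p₀} ≥ 1` a question about `A₀`, not decided here),
`credits (credit (lowerA C θ) g) G + θ·Σ_{births}(d′ + 1) ≤ credits (credit C g) G` (`credits_lowerA_add_le`), hence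

  `(∏_{t∈T} n_t!) · e^{−credits (credit C g) G} ≤ (1 + 2/θ)^{#births G} · e^{−credits (credit (lowerA C θ) g) G}`

(`prod_factorial_mul_exp_neg_credits_le`): the factorial-carrying pointwise multiplicity reduces to the landed shape of
`hlabM` with the constants `C ↦ lowerA C θ` (still `Valid`: `lowerA_valid`) and `c ↦ c·(1 + 2/θ)`.  K-free, pointwise,
every constant displayed.  Renewal and merger credits are untouched (`credit_lowerA_of_kind_ne`).

WHAT THIS FILE DOES NOT DO.  It does not re-type `hlabM` (the NEW binder carrying `∏_t n_t!` is the binder owner's, beside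
the landed one); it does not decide whether print's `½γ₀A₁²` (the `a` of (1.79)) has the room `θ` — an (E2)-side constant;
it does not touch the zone-target re-assembly of (GM) nor the instantiation (r1) behind the reading (ID).

HONEST DEPENDENCY (cell): continuum YM on T⁴ ⇐ BetaPertH ∧ nine spine estimates (0/9 proved); BetaPertH ⇐ (D1) ∧ (D4)
∧ CAP+tail.  This file changes none of it.
-/

open Finset
open scoped Nat
open Literature.MathematicalPhysics.QuantumFieldTheory.Balaban1983to89
open T4PersistenceDictionary T4BankedInduction T4PrintedShapeBanking

namespace Summit.QuantumFields.BalabanUV.T4Continuum.PlacementBatch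

noncomputable section

/-! ## §1 Lowering the quadratic birth constant -/

/-- The constants with the quadratic birth constant `a` lowered by `θ` (every other constant unchanged). [folklore] -/
def lowerA (C : T4PrintedShapeBanking.Consts) (θ : ℝ) : T4PrintedShapeBanking.Consts := { C with a := C.a - θ }

/-- the lowered `a` [folklore] -/
@[simp] theorem lowerA_a (C : T4PrintedShapeBanking.Consts) (θ : ℝ) : (lowerA C θ).a = C.a - θ := rfl
/-- `A₀` is unchanged [folklore] -/
@[simp] theorem lowerA_A₀ (C : T4PrintedShapeBanking.Consts) (θ : ℝ) : (lowerA C θ).A₀ = C.A₀ := rfl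
/-- `p₀` is unchanged [folklore] -/
@[simp] theorem lowerA_p₀ (C : T4PrintedShapeBanking.Consts) (θ : ℝ) : (lowerA C θ).p₀ = C.p₀ := rfl
/-- `μ` is unchanged [folklore] -/
@[simp] theorem lowerA_μ (C : T4PrintedShapeBanking.Consts) (θ : ℝ) : (lowerA C θ).μ = C.μ := rfl
/-- `κ₁` is unchanged [folklore] -/
@[simp] theorem lowerA_κ₁ (C : T4PrintedShapeBanking.Consts) (θ : ℝ) : (lowerA C θ).κ₁ = C.κ₁ := rfl
/-- `n₁` is unchanged [folklore] -/
@[simp] theorem lowerA_n₁ (C : T4PrintedShapeBanking.Consts) (θ : ℝ) : (lowerA C θ).n₁ = C.n₁ := rfl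
/-- lowering by `0` changes nothing [folklore] -/
@[simp] theorem lowerA_zero (C : T4PrintedShapeBanking.Consts) : lowerA C 0 = C := by cases C; simp [lowerA]

/-- `Valid` does not constrain `a`: the lowered constants are valid when the original ones are. [folklore] -/
theorem lowerA_valid {C : T4PrintedShapeBanking.Consts} (h : C.Valid) (θ : ℝ) : (lowerA C θ).Valid :=
  ⟨h.E₂_nonneg, h.E₃_nonneg, h.κ₁_nonneg, h.E₀_nonneg, h.Eb_nonneg, h.μ_nonneg, h.dC_le⟩

/-! ## §2 The birth credit, event by event -/

/-- a birth's credit, displayed: `a·p₀(g_s)²·(d′+1) + 2p₀(g_s)` [folklore] -/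
theorem credit_of_kind_eq_zero (C : T4PrintedShapeBanking.Consts) (g : ℕ → ℝ) {e : PEv} (h : e.kind = 0) :
    credit C g e = C.a * p0Profile C.A₀ C.p₀ (g e.step) ^ 2 * ((e.fat : ℝ) + 1) +
      2 * p0Profile C.A₀ C.p₀ (g e.step) := by
  simp [credit, h]

/-- renewal and merger credits do not see `a`. [folklore] -/
theorem credit_lowerA_of_kind_ne (C : T4PrintedShapeBanking.Consts) (g : ℕ → ℝ) (θ : ℝ) {e : PEv} (h : e.kind ≠ 0) :
    credit (lowerA C θ) g e = credit C g e := by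
  simp [credit, h]

/-- **ONE BIRTH.**  With `p₀(g_s) ≥ 1` at the birth's step and `θ ≥ 0`:
`credit (lowerA C θ) g e + θ·(d′ + 1) ≤ credit C g e`. [folklore] -/
theorem credit_lowerA_add_le {C : T4PrintedShapeBanking.Consts} {g : ℕ → ℝ} {θ : ℝ} (hθ : 0 ≤ θ) {e : PEv} (h : e.kind = 0)
    (hP : 1 ≤ p0Profile C.A₀ C.p₀ (g e.step)) :
    credit (lowerA C θ) g e + θ * ((e.fat : ℝ) + 1) ≤ credit C g e := by
  rw [credit_of_kind_eq_zero _ _ h, credit_of_kind_eq_zero _ _ h, lowerA_a, lowerA_A₀, lowerA_p₀]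
  set P := p0Profile C.A₀ C.p₀ (g e.step)
  have hf : 0 ≤ (e.fat : ℝ) + 1 := by positivity
  have hP2 : 1 ≤ P ^ 2 := by nlinarith
  have key : θ * ((e.fat : ℝ) + 1) ≤ θ * P ^ 2 * ((e.fat : ℝ) + 1) := by
    have := mul_le_mul_of_nonneg_left hP2 (mul_nonneg hθ hf)
    nlinarith
  nlinarith

/-! ## §3 The credits of a genealogy -/

/-- **ALL EVENTS.**  With `p₀(g_s) ≥ 1` at every birth step of `G` and `θ ≥ 0`:
`credits (credit (lowerA C θ) g) G + θ·Σ_{births of G}(d′ + 1) ≤ credits (credit C g) G`. [folklore] -/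
theorem credits_lowerA_add_le {C : T4PrintedShapeBanking.Consts} {g : ℕ → ℝ} {θ : ℝ} (hθ : 0 ≤ θ) (G : Gen PEv)
    (hP : ∀ e ∈ G.events, e.kind = 0 → 1 ≤ p0Profile C.A₀ C.p₀ (g e.step)) :
    credits (credit (lowerA C θ) g) G + θ * ∑ e ∈ G.events.filter (fun e => e.kind = 0), ((e.fat : ℝ) + 1) ≤
      credits (credit C g) G := by
  unfold credits
  rw [sum_filter, mul_sum, ← sum_add_distrib]
  refine sum_le_sum fun e he => ?_
  by_cases h : e.kind = 0
  · rw [if_pos h]; exact credit_lowerA_add_le hθ h (hP e he h)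
  · rw [if_neg h, mul_zero, add_zero, credit_lowerA_of_kind_ne C g θ h]

/-- the extracted class rate as a product of per-birth factors [folklore] -/
theorem exp_neg_credits_le {C : T4PrintedShapeBanking.Consts} {g : ℕ → ℝ} {θ : ℝ} (hθ : 0 ≤ θ) (G : Gen PEv)
    (hP : ∀ e ∈ G.events, e.kind = 0 → 1 ≤ p0Profile C.A₀ C.p₀ (g e.step)) :
    Real.exp (-credits (credit C g) G) ≤
      Real.exp (-credits (credit (lowerA C θ) g) G) *
        ∏ e ∈ G.events.filter (fun e => e.kind = 0), Real.exp (-(θ * (e.fat : ℝ))) := by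
  set B := G.events.filter (fun e => e.kind = 0)
  have hB : credits (credit (lowerA C θ) g) G + (∑ e ∈ B, θ * (e.fat : ℝ)) + θ * B.card ≤
      credits (credit C g) G := by
    have h := credits_lowerA_add_le hθ G hP
    have hs : θ * ∑ e ∈ B, ((e.fat : ℝ) + 1) = (∑ e ∈ B, θ * (e.fat : ℝ)) + θ * B.card := by
      rw [sum_add_distrib, mul_add, mul_sum, sum_const, nsmul_eq_mul, mul_one]
    linarith
  have hcard : Real.exp (-(θ * (B.card : ℝ))) ≤ 1 := Real.exp_le_one_iff.2 (neg_nonpos.2 (by positivity))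
  calc Real.exp (-credits (credit C g) G)
      ≤ Real.exp (-(credits (credit (lowerA C θ) g) G + (∑ e ∈ B, θ * (e.fat : ℝ)) + θ * B.card)) :=
        Real.exp_le_exp.2 (by linarith)
    _ = Real.exp (-credits (credit (lowerA C θ) g) G) * Real.exp (-∑ e ∈ B, θ * (e.fat : ℝ)) *
          Real.exp (-(θ * (B.card : ℝ))) := by rw [neg_add, neg_add, Real.exp_add, Real.exp_add]
    _ ≤ Real.exp (-credits (credit (lowerA C θ) g) G) * Real.exp (-∑ e ∈ B, θ * (e.fat : ℝ)) * 1 :=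
        mul_le_mul_of_nonneg_left hcard (by positivity)
    _ = Real.exp (-credits (credit (lowerA C θ) g) G) * ∏ e ∈ B, Real.exp (-(θ * (e.fat : ℝ))) := by
        rw [mul_one, ← sum_neg_distrib, Real.exp_sum]

/-! ## §4 The batch factorials against the credits -/

/-- **THE BATCH FACTORIALS ARE ABSORBED BY LOWERING `a` (pointwise, K-free).**  For `θ > 0`, a genealogy `G` whose
births have their steps in `T` and `p₀(g_s) ≥ 1` at those steps:
`(∏_{t∈T} n_t!) · e^{−credits (credit C g) G} ≤ (1 + 2/θ)^{#births G} · e^{−credits (credit (lowerA C θ) g) G}`,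
`n_t = #birthsAt G.events t`.  So a multiplicity `(∏_t n_t!)·c^{#events}·Λ′^{partnerAges}` feeds the landed shape of
`hlabM` with `C ↦ lowerA C θ`, `c ↦ c·(1 + 2/θ)`. [folklore] -/
theorem prod_factorial_mul_exp_neg_credits_le {θ : ℝ} (hθ : 0 < θ) (C : T4PrintedShapeBanking.Consts) (g : ℕ → ℝ) (G : Gen PEv)
    (T : Finset ℕ) (hT : ∀ e ∈ G.events, e.kind = 0 → e.step ∈ T)
    (hP : ∀ e ∈ G.events, e.kind = 0 → 1 ≤ p0Profile C.A₀ C.p₀ (g e.step)) :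
    (∏ t ∈ T, (((birthsAt G.events t).card)! : ℝ)) * Real.exp (-credits (credit C g) G) ≤
      (1 + 2 / θ) ^ (G.events.filter fun e => e.kind = 0).card *
        Real.exp (-credits (credit (lowerA C θ) g) G) := by
  set B := G.events.filter (fun e => e.kind = 0)
  have h1 := exp_neg_credits_le hθ.le G hP
  have h2 := prod_factorial_mul_credits_le hθ G.events T hT
  have h3 : ∏ e ∈ B, Real.exp (-(θ / 2 * (e.fat : ℝ))) ≤ 1 :=
    prod_le_one (fun _ _ => (Real.exp_pos _).le)
      fun e _ => Real.exp_le_one_iff.2 (neg_nonpos.2 (by positivity))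
  have hF : 0 ≤ ∏ t ∈ T, (((birthsAt G.events t).card)! : ℝ) := prod_nonneg fun _ _ => by positivity
  have hE : 0 ≤ Real.exp (-credits (credit (lowerA C θ) g) G) := (Real.exp_pos _).le
  calc (∏ t ∈ T, (((birthsAt G.events t).card)! : ℝ)) * Real.exp (-credits (credit C g) G)
      ≤ (∏ t ∈ T, (((birthsAt G.events t).card)! : ℝ)) *
          (Real.exp (-credits (credit (lowerA C θ) g) G) * ∏ e ∈ B, Real.exp (-(θ * (e.fat : ℝ)))) :=
        mul_le_mul_of_nonneg_left h1 hF
    _ = ((∏ t ∈ T, (((birthsAt G.events t).card)! : ℝ)) * ∏ e ∈ B, Real.exp (-(θ * (e.fat : ℝ)))) *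
          Real.exp (-credits (credit (lowerA C θ) g) G) := by ring
    _ ≤ ((1 + 2 / θ) ^ B.card * ∏ e ∈ B, Real.exp (-(θ / 2 * (e.fat : ℝ)))) *
          Real.exp (-credits (credit (lowerA C θ) g) G) := mul_le_mul_of_nonneg_right h2 hE
    _ ≤ ((1 + 2 / θ) ^ B.card * 1) * Real.exp (-credits (credit (lowerA C θ) g) G) :=
        mul_le_mul_of_nonneg_right (mul_le_mul_of_nonneg_left h3 (by positivity)) hE
    _ = (1 + 2 / θ) ^ B.card * Real.exp (-credits (credit (lowerA C θ) g) G) := by rw [mul_one]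

/-! ## §5 Sanity -/

namespace Sanity

/-- lowering by `θ = 1` a constant `a = 3` gives `a = 2`, and `μ` is untouched [folklore] -/
theorem lowerA_example :
    (lowerA ⟨9, 2, 5, 1, 1, 1, 1, 1, (1/2 : ℝ), 3, 1, 2⟩ 1).a = 2 ∧
      (lowerA ⟨9, 2, 5, 1, 1, 1, 1, 1, (1/2 : ℝ), 3, 1, 2⟩ 1).μ = 1/2 := by
  refine ⟨?_, rfl⟩
  show (3 : ℝ) - 1 = 2
  norm_num

/-- a lone birth `(4, 0, 7)`: the credit drops by at least `θ·(7+1)` when `p₀ ≥ 1` (here the profile is abstract; the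
inequality is `credit_lowerA_add_le` instantiated) [folklore] -/
theorem one_birth_example (C : T4PrintedShapeBanking.Consts) (g : ℕ → ℝ) (hP : 1 ≤ p0Profile C.A₀ C.p₀ (g 4)) :
    credit (lowerA C 1) g ((4 : ℕ), (0 : Fin 3), (7 : ℕ)) + 1 * ((7 : ℕ) + 1 : ℝ) ≤
      credit C g ((4 : ℕ), (0 : Fin 3), (7 : ℕ)) :=
  credit_lowerA_add_le (C := C) (g := g) zero_le_one (e := ((4 : ℕ), (0 : Fin 3), (7 : ℕ))) rfl hP

end Sanity

end

end Summit.QuantumFields.BalabanUV.T4Continuum.PlacementBatch
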